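import Summits.QuantumFields.YangMills.Theorems.SwapVirialDeficitSectorLaplacePlaneParts
import HarnessLib

/-!
# (S)-road under E1, stub S2i′: THE RESCALED BULK LAW INTEGRATED OVER THE BULK HUBS (no gnomonic cut), letters of ✓`SectorLaplaceDefs` §4
# (free-hands support of ⟨stmt-QuantumFields-24197⟩ `SwapVirialDeficit.SwapGluedStiffness` ∕ ⟨24194⟩ `SwapMeanActionGap`; cell ym-idea-1, assembler fcl-p3 g47)

w2 g59's E1 bulk law `bulk_fibred_plane` (signature posted 2026-08-31 18:35Z; rescaled fibre, whole base `ℝ²`) is POINTWISE in the hub: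
for `a ∈ HubBulk ψ₀`, good `ε` and `b ≥ (K L^k ψ₀^{−k})²`,
`|∫e^{−bF̂_{a,ε}}ρ − (2π∕b)^α·∫_{ℝ²}𝔪(a,ε,·)| ≤ K L^k ψ₀^{−k} b^{−1∕2}·(2π∕b)^α∫_{ℝ²}𝔪 + (∫ρ)·e^{−b(ψ₀∕(K L^k))^k}`.
The window assembly ✓`window_arith_plane` wants it INTEGRATED (input S2i′): `bulkHubIntegral L b ψ₀` against `mbHubBulk L ψ₀`.  Same bookkeeping as the boxed
✓`bulk_integrated_of_pointwise` (✓`SectorLaplaceBulkIntegrated`): the generic ✓`setIntegral_two_sided_of_pointwise` per sign pattern, the sum over good patterns,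
and `K_L·#signs·∫ρ = 1` (✓`gnomonic_total_mass_real`) for the absolute term.

* §1 `integrable_planeMass` (S3 ⟹ `a ↦ ∫_{ℝ²}𝔪(a,ε,·)` cone-integrable, `Integrable.integral_prod_left`), `planeMass_nonneg`, `mbHubBulk_nonneg`;
* §2 ★★ `bulkHub_integrated_of_pointwise` — S2′ (hypothesis, w2's signature VERBATIM) + S3 (hypothesis) ⟹ S2i′ (the `hS2i` of ✓`window_arith_plane` VERBATIM).

HONEST LABEL: measure-theoretic glue, conditional on S2′ (w2 g59, in progress) and S3 (hypotheses); ⟨24197⟩ ∕ ⟨24194⟩ OPEN; ⟨24196⟩ proved elsewhere; item of record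
⟨24085⟩ SubOctaveBounded aside ∕ untouched; the Yang–Mills mass gap is NOT proved; no summit is proved by a line.  THEOREMS ONLY (0 `def`, 0 `sorry`), standard
axioms; the `attribute [local instance]` block is the chart's measurable structure on `ℍ` (as in ✓`SectorLaplaceDefs`; nothing overridden).  Seat ym-line-fcl-p3 g47
(cell ym-idea-1, free hands), `--supports stmt-QuantumFields-24197`.  References: [cite: Luscher1983, §2]; [folklore].
-/

set_option autoImplicit false
set_option synthInstance.maxSize 1024

noncomputable section

open MeasureTheory Quaternion Set
open scoped Quaternion BigOperators ENNReal
open Literature.MathematicalPhysics.QuantumLattice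
open Literature.MathematicalPhysics.QuantumFieldTheory hiding SU2
open Summit.QuantumFields.YangMills.Theorems.SwapTwistDeficit.ToronLog

attribute [local instance] Literature.Analysis.FluidPDE.Tao2016.quatMeasurableSpace
  Literature.Analysis.FluidPDE.Tao2016.quatBorelSpace
  Literature.MathematicalPhysics.QuantumLattice.secondCountableTopology_su2

namespace Summit.QuantumFields.YangMills.Theorems.SwapVirialDeficit.SectorLaplace

open Summit.QuantumFields.YangMills.Theorems.FemtoTransferGap
open Summit.QuantumFields.YangMills.Theorems.FemtoTransferGap.TT
open Summit.QuantumFields.YangMills.Theorems.VirialFluxGap.RingDeficit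
open Summit.QuantumFields.YangMills.Theorems.SwapVirialDeficit.SwapRing
open Summit.QuantumFields.YangMills.Theorems.SwapVirialDeficit.BlowUpRing

variable {L : ℕ} [NeZero L]

/-! ## §1 The whole-base Morse–Bott mass as a function of the hub (given S3) -/

/-- ★ GIVEN S3's joint integrability, `a ↦ ∫_{ℝ²} 𝔪(a,ε,·)` is cone-integrable (`Integrable.integral_prod_left`). [folklore] -/
theorem integrable_planeMass {ε : GnoSign L}
    (hint : Integrable (fun ap : ℍ × (ℝ × ℝ) => mbDensity (L := L) ap.1 ε ap.2) (coneMeasure.prod volume)) :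
    Integrable (fun a : ℍ => ∫ p : ℝ × ℝ, mbDensity (L := L) a ε p) coneMeasure :=
  hint.integral_prod_left

/-- The whole-base mass is non-negative. [folklore] -/
theorem planeMass_nonneg (a : ℍ) (ε : GnoSign L) : 0 ≤ ∫ p : ℝ × ℝ, mbDensity (L := L) a ε p :=
  integral_nonneg fun p => mbDensity_nonneg a ε p

/-- `0 ≤ mbHubBulk`. [folklore] -/
theorem mbHubBulk_nonneg (ψ₀ : ℝ) : 0 ≤ mbHubBulk L ψ₀ := by
  unfold mbHubBulk
  exact mul_nonneg KL_nonneg (Finset.sum_nonneg fun ε _ =>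
    setIntegral_nonneg (measurableSet_hubBulk ψ₀) fun a _ => planeMass_nonneg a ε)

/-! ## §2 Stub S2i′ -/

set_option maxHeartbeats 400000 in
/-- ★★ **STUB S2i′ (the `hS2i` of ✓`window_arith_plane` VERBATIM) from S2′ (w2 g59's `bulk_fibred_plane`, signature of 2026-08-31 18:35Z verbatim) and S3.**
Integrate the pointwise law over `HubBulk ψ₀` against the probability `coneMeasure` (✓`setIntegral_two_sided_of_pointwise`), sum over the good sign patterns, and
absorb the absolute term with `K_L·#signs·∫ρ = 1` (✓`gnomonic_total_mass_real`). [cite: Luscher1983, §2] -/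
theorem bulkHub_integrated_of_pointwise
    (hS2 : ∃ K : ℝ, 0 < K ∧ ∃ k : ℕ, ∀ (L : ℕ) [NeZero L] (ψ₀ b : ℝ), 0 < ψ₀ → ψ₀ ≤ 1 →
      (K * (L : ℝ) ^ k * (1 / ψ₀) ^ k) ^ 2 ≤ b → ∀ a : ℍ, a ∈ HubBulk ψ₀ → ∀ ε : GnoSign L, GoodSign ε →
        |(∫ η : GnoCoord L, Real.exp (-(b * gnoDeficit z₀ (fun _ => 1) a ε η)) * gnoDensity η) -
            (2 * Real.pi / b) ^ alpha L * ∫ p, mbDensity a ε p| ≤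
          K * (L : ℝ) ^ k * (1 / ψ₀) ^ k * b ^ (-(1 / 2 : ℝ)) * ((2 * Real.pi / b) ^ alpha L * ∫ p, mbDensity a ε p) +
            (∫ η : GnoCoord L, gnoDensity η) * Real.exp (-(b * (ψ₀ / (K * (L : ℝ) ^ k)) ^ k)))
    (hS3 : ∀ (L : ℕ) [NeZero L] (ε : GnoSign L), GoodSign ε →
      (∀ a p, 0 ≤ mbDensity (L := L) a ε p) ∧ Measurable (fun ap : ℍ × (ℝ × ℝ) => mbDensity (L := L) ap.1 ε ap.2) ∧
        Integrable (fun ap : ℍ × (ℝ × ℝ) => mbDensity (L := L) ap.1 ε ap.2) (coneMeasure.prod volume)) :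
    ∃ K : ℝ, 0 < K ∧ ∃ k : ℕ, ∀ (L : ℕ) [NeZero L] (ψ₀ b : ℝ), 0 < ψ₀ → ψ₀ ≤ 1 →
      (K * (L : ℝ) ^ k * (1 / ψ₀) ^ k) ^ 2 ≤ b →
        0 ≤ mbHubBulk L ψ₀ ∧
        |bulkHubIntegral L b ψ₀ - (2 * Real.pi / b) ^ alpha L * mbHubBulk L ψ₀| ≤
          K * (L : ℝ) ^ k * (1 / ψ₀) ^ k * b ^ (-(1 / 2 : ℝ)) * ((2 * Real.pi / b) ^ alpha L * mbHubBulk L ψ₀) +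
            Real.exp (-(b * (ψ₀ / (K * (L : ℝ) ^ k)) ^ k)) := by
  obtain ⟨K, hK, k, h2⟩ := hS2
  refine ⟨K, hK, k, fun L _ ψ₀ b hψ0 hψ1 hb => ⟨mbHubBulk_nonneg ψ₀, ?_⟩⟩
  haveI := isProbabilityMeasure_coneMeasure
  have hb0 : 0 ≤ b := le_trans (sq_nonneg _) hb
  -- letters
  set S : Set ℍ := HubBulk ψ₀ with hSdef
  set A : ℝ := (2 * Real.pi / b) ^ alpha L with hAdef
  set r : ℝ := K * (L : ℝ) ^ k * (1 / ψ₀) ^ k * b ^ (-(1 / 2 : ℝ)) with hrdef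
  set E : ℝ := Real.exp (-(b * (ψ₀ / (K * (L : ℝ) ^ k)) ^ k)) with hEdef
  set M : ℝ := ∫ η : GnoCoord L, gnoDensity η with hMdef
  set G : Finset (GnoSign L) := Finset.univ.filter (fun ε : GnoSign L => GoodSign ε) with hGdef
  have hS : MeasurableSet S := measurableSet_hubBulk ψ₀
  have hSfin : coneMeasure S ≠ ⊤ := measure_ne_top _ _
  have hS1 : coneMeasure.real S ≤ 1 := by
    have h := prob_le_one (μ := coneMeasure) (s := S)
    rw [measureReal_def]
    exact ENNReal.toReal_le_of_le_ofReal zero_le_one (by rwa [ENNReal.ofReal_one])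
  have hM0 : 0 ≤ M := integral_nonneg fun η => (gnoDensity_pos η).le
  have hE0 : 0 ≤ E := (Real.exp_pos _).le
  have hKL : 0 ≤ KL L := KL_nonneg
  -- per good sign pattern: the integrated two-sided law on `S`
  have hper : ∀ ε ∈ G, |∫ a in S, hubIntegral a ε b ∂coneMeasure - A * ∫ a in S, (∫ p : ℝ × ℝ, mbDensity a ε p) ∂coneMeasure| ≤
      r * (A * ∫ a in S, (∫ p : ℝ × ℝ, mbDensity a ε p) ∂coneMeasure) + M * E := by
    intro ε hε
    rw [hGdef, Finset.mem_filter] at hε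
    obtain ⟨-, -, hint⟩ := hS3 L ε hε.2
    have hpt : ∀ a ∈ S, |hubIntegral a ε b - A * ∫ p : ℝ × ℝ, mbDensity a ε p| ≤ r * (A * ∫ p : ℝ × ℝ, mbDensity a ε p) + M * E :=
      fun a ha => h2 L ψ₀ b hψ0 hψ1 hb a ha ε hε.2
    have h := setIntegral_two_sided_of_pointwise hS hSfin (integrable_hubIntegral hb0 ε).integrableOn
      (integrable_planeMass hint).integrableOn hpt
    refine h.trans (add_le_add le_rfl ?_)
    calc M * E * coneMeasure.real S ≤ M * E * 1 := mul_le_mul_of_nonneg_left hS1 (mul_nonneg hM0 hE0)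
      _ = M * E := mul_one _
  -- sum over the good patterns
  have esum : bulkHubIntegral L b ψ₀ - A * mbHubBulk L ψ₀ =
      KL L * ∑ ε ∈ G, (∫ a in S, hubIntegral a ε b ∂coneMeasure - A * ∫ a in S, (∫ p : ℝ × ℝ, mbDensity a ε p) ∂coneMeasure) := by
    rw [Finset.sum_sub_distrib, ← Finset.mul_sum, mul_sub]
    simp only [bulkHubIntegral, mbHubBulk, ← hSdef, ← hGdef]
    ring
  have hsum : |bulkHubIntegral L b ψ₀ - A * mbHubBulk L ψ₀| ≤
      KL L * ∑ ε ∈ G, (r * (A * ∫ a in S, (∫ p : ℝ × ℝ, mbDensity a ε p) ∂coneMeasure) + M * E) := by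
    rw [esum, abs_mul, abs_of_nonneg hKL]
    exact mul_le_mul_of_nonneg_left ((Finset.abs_sum_le_sum_abs _ _).trans (Finset.sum_le_sum hper)) hKL
  -- the absolute term: `K_L · #G · M ≤ K_L · #all · M = 1`
  have htot := gnomonic_total_mass_real (L := L) (χ := fun _ => (1 : SU2)) one_central
  have habs : KL L * ∑ _ε ∈ G, M * E ≤ E := by
    calc KL L * ∑ _ε ∈ G, M * E ≤ KL L * ∑ _ε : GnoSign L, M * E :=
          mul_le_mul_of_nonneg_left (Finset.sum_le_sum_of_subset_of_nonneg (Finset.filter_subset _ _) fun ε _ _ => mul_nonneg hM0 hE0) hKL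
      _ = (KL L * ∑ _ε : GnoSign L, M) * E := by rw [Finset.mul_sum, Finset.mul_sum, Finset.sum_mul]; exact Finset.sum_congr rfl fun ε _ => by ring
      _ = E := by rw [hMdef]; unfold KL; rw [htot, one_mul]
  have emain : KL L * ∑ ε ∈ G, r * (A * ∫ a in S, (∫ p : ℝ × ℝ, mbDensity a ε p) ∂coneMeasure) = r * (A * mbHubBulk L ψ₀) := by
    simp only [mbHubBulk, ← hSdef, ← hGdef, Finset.mul_sum]
    exact Finset.sum_congr rfl fun ε _ => by ring
  calc |bulkHubIntegral L b ψ₀ - A * mbHubBulk L ψ₀|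
      ≤ KL L * ∑ ε ∈ G, (r * (A * ∫ a in S, (∫ p : ℝ × ℝ, mbDensity a ε p) ∂coneMeasure) + M * E) := hsum
    _ = KL L * ∑ ε ∈ G, r * (A * ∫ a in S, (∫ p : ℝ × ℝ, mbDensity a ε p) ∂coneMeasure) + KL L * ∑ _ε ∈ G, M * E := by
        rw [Finset.sum_add_distrib, mul_add]
    _ ≤ r * (A * mbHubBulk L ψ₀) + E := by rw [emain]; exact add_le_add le_rfl habs

end Summit.QuantumFields.YangMills.Theorems.SwapVirialDeficit.SectorLaplace

end
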